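import Summits.HubbardSuperconductivity.HubbardSuperconductivity.Theorems.AnisotropyChordTransferFibre3Hole2Bond

/-!
# Route `AnisotropyChord` / H0 rotor rung: HOLE₂ by the BOND Birman–Schwinger formulation — II: the theorem of channels

★ `twoHoleGap_of_channels`: for `2 ≤ L`, `0 < g < ε₁`,
`aKer L (2g) (2,0) ≤ ½` and `2·aKer L (2g) (1,1) − aKer L (2g) (2,0) ≤ ½` ⇒ `TwoHoleGap L g` (EVERY pair of holes).

Second half of the variational transcript of «bond Birman–Schwinger + Weyl» (see `…Fibre3Hole2Bond` for the idea and the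
one-hole `channel_bound`).  Here: the dimension count.  For a test function `φ` vanishing on the pair with `Σφ = 0`, suppose
`E[φ] − g‖φ‖² < ½·(boundary mass)`.  On the family `f_v = v₀δ_{z₁} + v₁δ_{z₂} − (v₀+v₁)/(V−2)·1_{∉ζ} + v₂φ` (`Σ f_v = 0`)
the two `s`-fluxes are a `ℂ`-linear map `ℂ³ → ℂ²`, so some `v ≠ 0` kills both (`LinearMap.ker_ne_bot_of_finrank_lt`); for that
`f_v` the two channel bounds give `½(bond masses) ≤ Q(f_v)`, while the bookkeeping `E ≤ ¼·guarded + ½·(bond masses)`,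
`guarded(f_v) = ‖v₂‖²·guarded(φ) = ‖v₂‖²(4E[φ] − 2·mass)` (p2's `guarded_sum_eq`) and `‖f_v‖² ≥ ‖v₀‖² + ‖v₁‖² + ‖v₂‖²‖φ‖²` give
`Q(f_v) − ½(bond masses) ≤ ‖v₂‖²(Q(φ) − ½mass) − g(‖v₀‖² + ‖v₁‖²) < 0` — contradiction (`half_nbr_le`).  `TwoHoleGap` then
follows exactly as in p2's `twoHoleGap_of_dualCert`.
Prover seat `hubbard-h0-rotor-p3` g4; helper for stmt-HubbardSuperconductivity-19089 (`--supports`, helper class).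
WHAT THIS IS NOT: nothing here proves superconductivity in the Hubbard model (rotor TARGET as worded stays FALSE, g15 verdict);
a sufficient condition for ONE hypothesis (HOLE₂) of ONE conditional reduction (rung 19089). Tree imports only; no sorry.
-/

set_option linter.dupNamespace false
set_option autoImplicit false

noncomputable section

open scoped BigOperators
open Complex Finset Module

namespace Summit.HubbardSuperconductivity.HubbardSuperconductivity.Theorems.AnisotropyChord.Transfer.Fibre3

namespace TwoHoleBS

variable (L : ℕ) [NeZero L]

/-! ## Bookkeeping: the torus form is at most the guarded form plus the bond masses -/

omit [NeZero L] in
/-- pointwise: a bond term is at most the guarded term plus the two hole indicators times itself. [folklore] -/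
theorem bond_le_guard (z₁ z₂ : Tor L) (f : Tor L → ℂ) (x e : Tor L) :
    ‖f x - f (x + e)‖ ^ 2
      ≤ (if (x = z₁ ∨ x = z₂ ∨ x + e = z₁ ∨ x + e = z₂) then (0 : ℝ) else ‖f x - f (x + e)‖ ^ 2)
        + (if (x = z₁ ∨ x = z₂) then ‖f x - f (x + e)‖ ^ 2 else 0)
        + (if (x + e = z₁ ∨ x + e = z₂) then ‖f x - f (x + e)‖ ^ 2 else 0) := by
  have hT : 0 ≤ ‖f x - f (x + e)‖ ^ 2 := by positivity
  by_cases ha : (x = z₁ ∨ x = z₂)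
  · have hc : (x = z₁ ∨ x = z₂ ∨ x + e = z₁ ∨ x + e = z₂) := by
      rcases ha with h | h
      · exact Or.inl h
      · exact Or.inr (Or.inl h)
    rw [if_pos hc, if_pos ha]
    split_ifs <;> linarith
  · by_cases hb : (x + e = z₁ ∨ x + e = z₂)
    · have hc : (x = z₁ ∨ x = z₂ ∨ x + e = z₁ ∨ x + e = z₂) := by
        rcases hb with h | h
        · exact Or.inr (Or.inr (Or.inl h))
        · exact Or.inr (Or.inr (Or.inr h))
      rw [if_pos hc, if_neg ha, if_pos hb]
      linarith
    · have hc : ¬ (x = z₁ ∨ x = z₂ ∨ x + e = z₁ ∨ x + e = z₂) := by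
        push Not at ha hb ⊢
        exact ⟨ha.1, ha.2, hb.1, hb.2⟩
      rw [if_neg hc, if_neg ha, if_neg hb]
      linarith

/-- one direction of the bookkeeping: `Σ_x ‖f x − f(x+e)‖² ≤ Σ_x guarded + (hole terms) + (shifted hole terms)`. [folklore] -/
theorem dir_le_guard {z₁ z₂ : Tor L} (hne : z₁ ≠ z₂) (f : Tor L → ℂ) (e : Tor L) :
    ∑ x : Tor L, ‖f x - f (x + e)‖ ^ 2
      ≤ (∑ x : Tor L, (if (x = z₁ ∨ x = z₂ ∨ x + e = z₁ ∨ x + e = z₂) then (0 : ℝ) else ‖f x - f (x + e)‖ ^ 2))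
        + (‖f z₁ - f (z₁ + e)‖ ^ 2 + ‖f z₂ - f (z₂ + e)‖ ^ 2)
        + (‖f (z₁ - e) - f z₁‖ ^ 2 + ‖f (z₂ - e) - f z₂‖ ^ 2) := by
  calc ∑ x : Tor L, ‖f x - f (x + e)‖ ^ 2
      ≤ ∑ x : Tor L, ((if (x = z₁ ∨ x = z₂ ∨ x + e = z₁ ∨ x + e = z₂) then (0 : ℝ) else ‖f x - f (x + e)‖ ^ 2)
          + (if (x = z₁ ∨ x = z₂) then ‖f x - f (x + e)‖ ^ 2 else 0)
          + (if (x + e = z₁ ∨ x + e = z₂) then ‖f x - f (x + e)‖ ^ 2 else 0)) :=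
        Finset.sum_le_sum fun x _ => bond_le_guard L z₁ z₂ f x e
    _ = _ := by
        rw [Finset.sum_add_distrib, Finset.sum_add_distrib, sum_ite_pair L hne, sum_ite_pair_shift L hne]
        simp only [sub_add_cancel]

/-- ★ BOOKKEEPING INEQUALITY: for any `f` and any pair `z₁ ≠ z₂`,
`E[f] ≤ ¼·guarded(f) + ½·(Σ_e‖f z₁ − f(z₁+e)‖² + Σ_e‖f z₂ − f(z₂+e)‖²)`
(equality up to the doubly-counted bonds joining the two holes). [folklore] -/
theorem dirichletW_le_guard {z₁ z₂ : Tor L} (hne : z₁ ≠ z₂) (f : Tor L → ℂ) :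
    dirichletW L f ≤ (1 / 4 : ℝ) * guardSum L z₁ z₂ f + (1 / 2 : ℝ) * (bmass L f z₁ + bmass L f z₂) := by
  unfold dirichletW guardSum
  simp_rw [nnList_map_sum]
  simp only [Finset.sum_add_distrib]
  have h1 := dir_le_guard L hne f (ex L)
  have h2 := dir_le_guard L hne f (-ex L)
  have h3 := dir_le_guard L hne f (ey L)
  have h4 := dir_le_guard L hne f (-ey L)
  rw [bmass_four, bmass_four]
  simp only [sub_neg_eq_add, ← sub_eq_add_neg] at h1 h2 h3 h4 ⊢
  have e1 : ‖f (z₁ - ex L) - f z₁‖ = ‖f z₁ - f (z₁ - ex L)‖ := norm_sub_rev _ _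
  have e2 : ‖f (z₂ - ex L) - f z₂‖ = ‖f z₂ - f (z₂ - ex L)‖ := norm_sub_rev _ _
  have e3 : ‖f (z₁ + ex L) - f z₁‖ = ‖f z₁ - f (z₁ + ex L)‖ := norm_sub_rev _ _
  have e4 : ‖f (z₂ + ex L) - f z₂‖ = ‖f z₂ - f (z₂ + ex L)‖ := norm_sub_rev _ _
  have e5 : ‖f (z₁ - ey L) - f z₁‖ = ‖f z₁ - f (z₁ - ey L)‖ := norm_sub_rev _ _
  have e6 : ‖f (z₂ - ey L) - f z₂‖ = ‖f z₂ - f (z₂ - ey L)‖ := norm_sub_rev _ _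
  have e7 : ‖f (z₁ + ey L) - f z₁‖ = ‖f z₁ - f (z₁ + ey L)‖ := norm_sub_rev _ _
  have e8 : ‖f (z₂ + ey L) - f z₂‖ = ‖f z₂ - f (z₂ + ey L)‖ := norm_sub_rev _ _
  rw [e1, e2] at h1
  rw [e3, e4] at h2
  rw [e5, e6] at h3
  rw [e7, e8] at h4
  linarith

/-- for `φ` vanishing on the pair, `¼·guarded(φ) = E[φ] − ½(nbr φ z₁ + nbr φ z₂)` (p2's `guarded_sum_eq`). [folklore] -/
theorem guardSum_eq_of_vanish {z₁ z₂ : Tor L} (hne : z₁ ≠ z₂) {φ : Tor L → ℂ} (h1 : φ z₁ = 0) (h2 : φ z₂ = 0) :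
    (1 / 4 : ℝ) * guardSum L z₁ z₂ φ = dirichletW L φ - (1 / 2 : ℝ) * (nbr L φ z₁ + nbr L φ z₂) := by
  have hcut : cut L z₁ z₂ φ = φ := by
    funext x
    unfold cut
    split_ifs with hx
    · rcases hx with hx | hx
      · rw [hx, h1]
      · rw [hx, h2]
    · rfl
  have := guarded_sum_eq L hne φ
  rw [hcut] at this
  exact this

/-! ## The dimension count on the family `f_v` (defined in `…Hole2Bond`) -/

omit [NeZero L] in
/-- some `v ≠ 0` kills both fluxes. [folklore] -/
theorem exists_flux_zero (z₁ z₂ : Tor L) (φ : Tor L → ℂ) :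
    ∃ v : Fin 3 → ℂ, v ≠ 0 ∧ sflux L (fam L z₁ z₂ φ v) z₁ = 0 ∧ sflux L (fam L z₁ z₂ φ v) z₂ = 0 := by
  have hlt : finrank ℂ (Fin 2 → ℂ) < finrank ℂ (Fin 3 → ℂ) := by
    rw [Module.finrank_fin_fun, Module.finrank_fin_fun]; norm_num
  have hker := LinearMap.ker_ne_bot_of_finrank_lt (f := fluxMap L z₁ z₂ φ) hlt
  obtain ⟨v, hv, hv0⟩ := (Submodule.ne_bot_iff _).1 hker
  rw [LinearMap.mem_ker] at hv
  refine ⟨v, hv0, ?_, ?_⟩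
  · have := congrFun hv 0
    simpa [fluxMap] using this
  · have := congrFun hv 1
    simpa [fluxMap] using this

/-- `Σ_x [x ∈ ζ]·h x = h z₁ + h z₂` for complex `h`. [folklore] -/
theorem sum_ite_pair_complex {z₁ z₂ : Tor L} (hne : z₁ ≠ z₂) (h : Tor L → ℂ) :
    ∑ x : Tor L, (if (x = z₁ ∨ x = z₂) then h x else 0) = h z₁ + h z₂ := by
  rw [← Finset.sum_filter]
  have : (Finset.univ.filter fun x : Tor L => x = z₁ ∨ x = z₂) = {z₁, z₂} := by
    ext x; simp
  rw [this, Finset.sum_pair hne]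

/-- `Σ_x [x ∉ ζ] = V − 2` (complex). [folklore] -/
theorem sum_off_pair {z₁ z₂ : Tor L} (hne : z₁ ≠ z₂) :
    ∑ x : Tor L, (if (x = z₁ ∨ x = z₂) then (0 : ℂ) else 1) = (L : ℂ) ^ 2 - 2 := by
  have h : ∀ x : Tor L, (if (x = z₁ ∨ x = z₂) then (0 : ℂ) else 1) = 1 - (if (x = z₁ ∨ x = z₂) then (1 : ℂ) else 0) := by
    intro x; split_ifs <;> simp
  simp_rw [h]
  rw [Finset.sum_sub_distrib, sum_ite_pair_complex L hne (fun _ => (1 : ℂ)), Finset.sum_const, Finset.card_univ,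
    nsmul_eq_mul, mul_one]
  have hcard : (Fintype.card (Tor L) : ℂ) = (L : ℂ) ^ 2 := by
    rw [Fintype.card_prod, ZMod.card]; push_cast; ring
  rw [hcard]; ring

omit [NeZero L] in
/-- `V − 2 ≠ 0` in `ℂ` for `L ≥ 2`. [folklore] -/
theorem Vsub_two_ne_zero (hL : 2 ≤ L) : ((L : ℂ) ^ 2 - 2) ≠ 0 := by
  have h2 : (2 : ℝ) ≤ L := by exact_mod_cast hL
  have hpos : (0 : ℝ) < (L : ℝ) ^ 2 - 2 := by nlinarith
  have : ((L : ℂ) ^ 2 - 2) = (((L : ℝ) ^ 2 - 2 : ℝ) : ℂ) := by push_cast; ring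
  rw [this]
  exact_mod_cast hpos.ne'

/-- the family has zero sum (`L ≥ 2`, `Σφ = 0`). [folklore] -/
theorem sum_fam (hL : 2 ≤ L) {z₁ z₂ : Tor L} (hne : z₁ ≠ z₂) {φ : Tor L → ℂ} (hsum : ∑ x : Tor L, φ x = 0)
    (v : Fin 3 → ℂ) : ∑ x : Tor L, fam L z₁ z₂ φ v x = 0 := by
  unfold fam
  rw [Finset.sum_add_distrib, Finset.sum_add_distrib, Finset.sum_add_distrib, ← Finset.mul_sum, ← Finset.mul_sum,
    ← Finset.mul_sum, ← Finset.mul_sum, hsum, sum_off_pair L hne, Finset.sum_ite_eq', Finset.sum_ite_eq']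
  simp only [Finset.mem_univ, if_true]
  have hV := Vsub_two_ne_zero L hL
  field_simp
  ring

omit [NeZero L] in
/-- the family at the first hole. [folklore] -/
theorem fam_z₁ {z₁ z₂ : Tor L} (hne : z₁ ≠ z₂) {φ : Tor L → ℂ} (h1 : φ z₁ = 0) (v : Fin 3 → ℂ) :
    fam L z₁ z₂ φ v z₁ = v 0 := by
  simp [fam, hne, h1]

omit [NeZero L] in
/-- the family at the second hole. [folklore] -/
theorem fam_z₂ {z₁ z₂ : Tor L} (hne : z₁ ≠ z₂) {φ : Tor L → ℂ} (h2 : φ z₂ = 0) (v : Fin 3 → ℂ) :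
    fam L z₁ z₂ φ v z₂ = v 1 := by
  simp [fam, hne.symm, h2]

omit [NeZero L] in
/-- the family off the pair. [folklore] -/
theorem fam_off {z₁ z₂ : Tor L} {φ : Tor L → ℂ} (v : Fin 3 → ℂ) {x : Tor L} (hx : ¬ (x = z₁ ∨ x = z₂)) :
    fam L z₁ z₂ φ v x = -(v 0 + v 1) / ((L : ℂ) ^ 2 - 2) + v 2 * φ x := by
  push Not at hx
  simp [fam, hx.1, hx.2]

/-- the guarded sum scales: `guarded(f_v) = ‖v₂‖²·guarded(φ)`. [folklore] -/
theorem guardSum_fam (z₁ z₂ : Tor L) (φ : Tor L → ℂ) (v : Fin 3 → ℂ) :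
    guardSum L z₁ z₂ (fam L z₁ z₂ φ v) = ‖v 2‖ ^ 2 * guardSum L z₁ z₂ φ := by
  unfold guardSum
  rw [Finset.mul_sum]
  refine Finset.sum_congr rfl fun x _ => ?_
  simp_rw [nnList_map_sum]
  have key : ∀ e : Tor L,
      (if (x = z₁ ∨ x = z₂ ∨ x + e = z₁ ∨ x + e = z₂) then (0 : ℝ)
        else ‖fam L z₁ z₂ φ v x - fam L z₁ z₂ φ v (x + e)‖ ^ 2)
      = ‖v 2‖ ^ 2 * (if (x = z₁ ∨ x = z₂ ∨ x + e = z₁ ∨ x + e = z₂) then (0 : ℝ) else ‖φ x - φ (x + e)‖ ^ 2) := by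
    intro e
    split_ifs with hc
    · simp
    · push Not at hc
      have hx : ¬ (x = z₁ ∨ x = z₂) := by push Not; exact ⟨hc.1, hc.2.1⟩
      have hxe : ¬ (x + e = z₁ ∨ x + e = z₂) := by push Not; exact ⟨hc.2.2.1, hc.2.2.2⟩
      rw [fam_off L v hx, fam_off L v hxe]
      have : -(v 0 + v 1) / ((L : ℂ) ^ 2 - 2) + v 2 * φ x - (-(v 0 + v 1) / ((L : ℂ) ^ 2 - 2) + v 2 * φ (x + e))
          = v 2 * (φ x - φ (x + e)) := by ring
      rw [this, norm_mul, mul_pow]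
  rw [key, key, key, key]
  ring

/-- the mass of the family: `‖v₀‖² + ‖v₁‖² + ‖v₂‖²‖φ‖² ≤ ‖f_v‖²` (the frame part is orthogonal to `φ`). [folklore] -/
theorem normsq_fam_ge {z₁ z₂ : Tor L} (hne : z₁ ≠ z₂) {φ : Tor L → ℂ} (h1 : φ z₁ = 0) (h2 : φ z₂ = 0)
    (hsum : ∑ x : Tor L, φ x = 0) (v : Fin 3 → ℂ) :
    ‖v 0‖ ^ 2 + ‖v 1‖ ^ 2 + ‖v 2‖ ^ 2 * ∑ x : Tor L, ‖φ x‖ ^ 2 ≤ ∑ x : Tor L, ‖fam L z₁ z₂ φ v x‖ ^ 2 := by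
  set κ : ℂ := -(v 0 + v 1) / ((L : ℂ) ^ 2 - 2) with hκ
  -- pointwise decomposition of `‖f_v x‖²`
  have hpt : ∀ x : Tor L, ‖fam L z₁ z₂ φ v x‖ ^ 2
      = (if x = z₁ then ‖v 0‖ ^ 2 else 0) + (if x = z₂ then ‖v 1‖ ^ 2 else 0)
        + (if (x = z₁ ∨ x = z₂) then (0 : ℝ) else ‖κ‖ ^ 2)
        + ‖v 2‖ ^ 2 * ‖φ x‖ ^ 2 + 2 * (κ * (starRingEnd ℂ) (v 2 * φ x)).re := by
    intro x
    by_cases hx : (x = z₁ ∨ x = z₂)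
    · rcases hx with hx | hx
      · subst hx
        rw [fam_z₁ L hne h1]
        simp [hne, h1]
      · subst hx
        rw [fam_z₂ L hne h2]
        simp [hne.symm, h2]
    · rw [fam_off L v hx, if_neg hx]
      have hx' := hx
      push Not at hx'
      rw [if_neg hx'.1, if_neg hx'.2, Complex.sq_norm, Complex.sq_norm, Complex.sq_norm, Complex.sq_norm,
        Complex.normSq_add, Complex.normSq_mul]
      ring
  -- the cross term sums to zero
  have hcross : ∑ x : Tor L, 2 * (κ * (starRingEnd ℂ) (v 2 * φ x)).re = 0 := by
    rw [← Finset.mul_sum, ← Complex.re_sum, ← Finset.mul_sum]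
    simp_rw [map_mul]
    rw [← Finset.mul_sum, ← map_sum, hsum, map_zero, mul_zero, mul_zero, Complex.zero_re, mul_zero]
  have hκ0 : 0 ≤ ∑ x : Tor L, (if (x = z₁ ∨ x = z₂) then (0 : ℝ) else ‖κ‖ ^ 2) :=
    Finset.sum_nonneg fun x _ => by split_ifs <;> positivity
  rw [Finset.sum_congr rfl fun x _ => hpt x, Finset.sum_add_distrib, Finset.sum_add_distrib, Finset.sum_add_distrib,
    Finset.sum_add_distrib, hcross, Finset.sum_ite_eq', Finset.sum_ite_eq', ← Finset.mul_sum]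
  simp only [Finset.mem_univ, if_true]
  linarith

/-! ## The theorem of channels -/

/-- ★ the boundary-mass inequality for test functions vanishing on the pair (`0 < g < ε₁`, channels `≤ ½`):
`½(nbr φ z₁ + nbr φ z₂) ≤ E[φ] − g‖φ‖²`. [folklore] -/
theorem half_nbr_le (hL : 2 ≤ L) {g : ℝ} (hg0 : 0 < g) (hg : g < eps1 L)
    (h1 : aKer L (2 * g) (ex L + ex L) ≤ 1 / 2)
    (h2 : 2 * aKer L (2 * g) (ex L + ey L) - aKer L (2 * g) (ex L + ex L) ≤ 1 / 2)
    {z₁ z₂ : Tor L} (hne : z₁ ≠ z₂) (φ : Tor L → ℂ) (hφ1 : φ z₁ = 0) (hφ2 : φ z₂ = 0)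
    (hsum : ∑ x : Tor L, φ x = 0) :
    (1 / 2 : ℝ) * (nbr L φ z₁ + nbr L φ z₂) ≤ dirichletW L φ - g * ∑ x : Tor L, ‖φ x‖ ^ 2 := by
  by_contra hcon
  push Not at hcon
  obtain ⟨v, hv0, hs1, hs2⟩ := exists_flux_zero L z₁ z₂ φ
  have hfsum : ∑ x : Tor L, fam L z₁ z₂ φ v x = 0 := sum_fam L hL hne hsum v
  have hc1 := channel_bound L hL hg h1 h2 (fam L z₁ z₂ φ v) hfsum z₁ hs1
  have hc2 := channel_bound L hL hg h1 h2 (fam L z₁ z₂ φ v) hfsum z₂ hs2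
  have hdir := dirichletW_le_guard L hne (fam L z₁ z₂ φ v)
  have hgs : guardSum L z₁ z₂ (fam L z₁ z₂ φ v) = ‖v 2‖ ^ 2 * guardSum L z₁ z₂ φ := guardSum_fam L z₁ z₂ φ v
  have hgφ := guardSum_eq_of_vanish L hne hφ1 hφ2
  have hnorm := normsq_fam_ge L hne hφ1 hφ2 hsum v
  unfold Qf at hc1 hc2
  rw [hgs] at hdir
  have hGt : ‖v 2‖ ^ 2 * ((1 / 4 : ℝ) * guardSum L z₁ z₂ φ)
      = ‖v 2‖ ^ 2 * (dirichletW L φ - (1 / 2 : ℝ) * (nbr L φ z₁ + nbr L φ z₂)) := by rw [hgφ]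
  have hg4 := mul_le_mul_of_nonneg_left hnorm hg0.le
  -- collect: g(‖v₀‖² + ‖v₁‖²) + ‖v₂‖²·m ≤ 0 with m > 0
  have hkey : g * (‖v 0‖ ^ 2 + ‖v 1‖ ^ 2)
      + ‖v 2‖ ^ 2 * ((1 / 2 : ℝ) * (nbr L φ z₁ + nbr L φ z₂) - (dirichletW L φ - g * ∑ x : Tor L, ‖φ x‖ ^ 2)) ≤ 0 := by
    linarith
  have hmpos : 0 < (1 / 2 : ℝ) * (nbr L φ z₁ + nbr L φ z₂) - (dirichletW L φ - g * ∑ x : Tor L, ‖φ x‖ ^ 2) := by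
    linarith
  have hv00 : 0 ≤ ‖v 0‖ ^ 2 := by positivity
  have hv10 : 0 ≤ ‖v 1‖ ^ 2 := by positivity
  have hv20 : 0 ≤ ‖v 2‖ ^ 2 := by positivity
  have hA : 0 ≤ g * (‖v 0‖ ^ 2 + ‖v 1‖ ^ 2) := by positivity
  have hB : 0 ≤ ‖v 2‖ ^ 2 * ((1 / 2 : ℝ) * (nbr L φ z₁ + nbr L φ z₂)
      - (dirichletW L φ - g * ∑ x : Tor L, ‖φ x‖ ^ 2)) := mul_nonneg hv20 hmpos.le
  have hA0 : g * (‖v 0‖ ^ 2 + ‖v 1‖ ^ 2) = 0 := le_antisymm (by linarith) hA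
  have hB0 : ‖v 2‖ ^ 2 * ((1 / 2 : ℝ) * (nbr L φ z₁ + nbr L φ z₂)
      - (dirichletW L φ - g * ∑ x : Tor L, ‖φ x‖ ^ 2)) = 0 := le_antisymm (by linarith) hB
  have hs0 : ‖v 0‖ ^ 2 + ‖v 1‖ ^ 2 = 0 := by
    rcases mul_eq_zero.1 hA0 with h | h
    · exact absurd h hg0.ne'
    · exact h
  have hv0' : ‖v 0‖ ^ 2 = 0 := le_antisymm (by linarith) hv00
  have hv1' : ‖v 1‖ ^ 2 = 0 := le_antisymm (by linarith) hv10
  have hv2' : ‖v 2‖ ^ 2 = 0 := by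
    rcases mul_eq_zero.1 hB0 with h | h
    · exact h
    · exact absurd h hmpos.ne'
  have e0 : v 0 = 0 := by rwa [sq_eq_zero_iff, norm_eq_zero] at hv0'
  have e1 : v 1 = 0 := by rwa [sq_eq_zero_iff, norm_eq_zero] at hv1'
  have e2 : v 2 = 0 := by rwa [sq_eq_zero_iff, norm_eq_zero] at hv2'
  apply hv0
  funext i
  fin_cases i
  · exact e0
  · exact e1
  · exact e2

/-- ★★ THEOREM OF CHANNELS (bond Birman–Schwinger + Weyl): for `2 ≤ L` and `0 < g < ε₁`, if at `λ = 2g`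
`aKer L (2g) (2eₓ) ≤ ½` and `2·aKer L (2g) (eₓ + e_y) − aKer L (2g) (2eₓ) ≤ ½`, then `TwoHoleGap L g` — the two-hole
Poincaré inequality for EVERY pair of holes, every separation, with no skeleton and no capacity. [folklore] -/
theorem twoHoleGap_of_channels (hL : 2 ≤ L) {g : ℝ} (hg0 : 0 < g) (hg : g < eps1 L)
    (h1 : aKer L (2 * g) (ex L + ex L) ≤ 1 / 2)
    (h2 : 2 * aKer L (2 * g) (ex L + ey L) - aKer L (2 * g) (ex L + ex L) ≤ 1 / 2) :
    TwoHoleGap L g := by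
  intro z₁ z₂ hne f hmean
  have hφ1 : cut L z₁ z₂ f z₁ = 0 := by simp [cut]
  have hφ2 : cut L z₁ z₂ f z₂ = 0 := by simp [cut]
  have hsum : ∑ x : Tor L, cut L z₁ z₂ f x = 0 := hmean
  have hc := half_nbr_le L hL hg0 hg h1 h2 hne (cut L z₁ z₂ f) hφ1 hφ2 hsum
  rw [guarded_sum_eq L hne f]
  have hn : ∑ x : Tor L, (if (x = z₁ ∨ x = z₂) then (0 : ℝ) else ‖f x‖ ^ 2)
      = ∑ x : Tor L, ‖cut L z₁ z₂ f x‖ ^ 2 := by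
    refine Finset.sum_congr rfl fun x _ => ?_
    rw [norm_cut_sq]
  rw [hn]
  linarith

/-- the same with the two lattice points written as `ℤ`-coordinate pairs `(2,0)` and `(1,1)` (the form in which the
tree's window lemmas `dev_two_zero`, `dev_one_one`, `mem_greenW` speak). [folklore] -/
theorem twoHoleGap_of_channels_int (hL : 2 ≤ L) {g : ℝ} (hg0 : 0 < g) (hg : g < eps1 L)
    (h1 : aKer L (2 * g) ((((2 : ℤ)) : ZMod L), (((0 : ℤ)) : ZMod L)) ≤ 1 / 2)
    (h2 : 2 * aKer L (2 * g) ((((1 : ℤ)) : ZMod L), (((1 : ℤ)) : ZMod L))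
      - aKer L (2 * g) ((((2 : ℤ)) : ZMod L), (((0 : ℤ)) : ZMod L)) ≤ 1 / 2) :
    TwoHoleGap L g := by
  have e20 : (ex L + ex L : Tor L) = ((((2 : ℤ)) : ZMod L), (((0 : ℤ)) : ZMod L)) := by
    unfold ex; ext <;> push_cast <;> simp; norm_num
  have e11 : (ex L + ey L : Tor L) = ((((1 : ℤ)) : ZMod L), (((1 : ℤ)) : ZMod L)) := by
    unfold ex ey; ext <;> push_cast <;> simp
  refine twoHoleGap_of_channels L hL hg0 hg ?_ ?_
  · rw [e20]; exact h1
  · rw [e20, e11]; exact h2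

/-- the same with the two lattice points written as `ℕ`-coordinate pairs (the form of g3's `mem_greenW`). [folklore] -/
theorem twoHoleGap_of_channels_nat (hL : 2 ≤ L) {g : ℝ} (hg0 : 0 < g) (hg : g < eps1 L)
    (h1 : aKer L (2 * g) ((((2 : ℕ)) : ZMod L), (((0 : ℕ)) : ZMod L)) ≤ 1 / 2)
    (h2 : 2 * aKer L (2 * g) ((((1 : ℕ)) : ZMod L), (((1 : ℕ)) : ZMod L))
      - aKer L (2 * g) ((((2 : ℕ)) : ZMod L), (((0 : ℕ)) : ZMod L)) ≤ 1 / 2) :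
    TwoHoleGap L g := by
  have e20 : (ex L + ex L : Tor L) = ((((2 : ℕ)) : ZMod L), (((0 : ℕ)) : ZMod L)) := by
    unfold ex; ext <;> push_cast <;> simp; norm_num
  have e11 : (ex L + ey L : Tor L) = ((((1 : ℕ)) : ZMod L), (((1 : ℕ)) : ZMod L)) := by
    unfold ex ey; ext <;> push_cast <;> simp
  refine twoHoleGap_of_channels L hL hg0 hg ?_ ?_
  · rw [e20]; exact h1
  · rw [e20, e11]; exact h2

end TwoHoleBS

end Summit.HubbardSuperconductivity.HubbardSuperconductivity.Theorems.AnisotropyChord.Transfer.Fibre3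

end
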